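import Summits.CriticalPhenomena.SAWScalingLimit.Theorems.SAWLeftRightFKGFKGToTraversalBoundWitnessCfg
import Summits.CriticalPhenomena.SAWScalingLimit.Theorems.SAWLeftRightFKGFKGToTraversalBoundRankDesc
import HarnessLib

/-!
# Witness glue T4, part 1: piece facts and the rank of far pieces (line `slit-necklace`)

Crux `SAWLeftRightFKG.FKGToTraversalBound` (stmt-CriticalPhenomena-1878), line `slit-necklace`, lead
prover-line-stmt-CriticalPhenomena-1878-c5-0; witness glue unit T4 (child side and rank), on top of the vocabulary
`…WitnessCfg` (`PresCfg`, `pend`, `NonDeg`, `V`, `U`, `compU`, `rootAt`, `desc`, `rk`) and the abstract rank lemma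
`card_desc_lt_of_mem_desc` (`…RankDesc`).

Small closed facts about the pieces of the chord `γ` of a presented configuration `cfg : PresCfg D`:

* sub-walks of a walk between two indices, as lattice walks whose support consists of the vertices of
  intermediate index (`child_subwalk`);
* the end `cfg.pend i'` of the piece starting at `i'` is THE end (`child_pend_spec`, `child_pend_eq`), a far start
  starts a piece (`child_isPiece_of_mem_farStarts`);
* interiors of distinct pieces are disjoint (`child_V_disjoint`), the interior of a piece is joined to its first
  vertex inside itself (`child_V_walk`), and the interior of a NON-DEGENERATE piece lies in the free territory
  `U = Λ ∖ Sp` (`child_getVert_mem_U`, `child_V_subset_U`);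
* the `U`-component `compU` is an equivalence class and `rootAt` depends only on it (`child_compU_eq_of_mem`,
  `child_rootAt_congr`), vertices of the presenting walk `C` are off `Λ` (`child_notMem_Λ_of_mem_support`).

Registered helper `child_rk_lt_of_mem_desc`: for a non-degenerate far piece `i`, every `i'' ∈ desc i` has
`rk i'' < rk i` — `card_desc_lt_of_mem_desc` instantiated with the non-degenerate far pieces of the `U`-component of
`γ (i + 1)`, their interiors and the root `rootAt (γ (i + 1))`; on these pieces `desc` IS the abstract descendant set
because components and roots agree inside one `U`-component.  All statements folklore; nothing restates the crux.
-/

noncomputable section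

open Set
open Literature.Probability.LatticeModels
open Literature.Probability.RandomPlanarGeometry
open Literature.Probability.RandomPlanarGeometry.SAW
open Summit.CriticalPhenomena.SAWScalingLimit.Theorems.FKGToTraversalBound.Negative (dom)

namespace Summit.CriticalPhenomena.SAWScalingLimit.Theorems.FKGToTraversalBound.SlitNecklace

/-! ### Sub-walks between two indices -/

section Subwalk

variable {V : Type*} {H G : SimpleGraph V} {u v : V}

/-- **Sub-walk by indices.** For a walk `p` of a subgraph `H ≤ G` and `a + k ≤ |p|`, a `G`-walk from
`p (a)` to `p (a + k)` all of whose vertices are vertices `p m` with `a ≤ m ≤ a + k`. [folklore] -/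
theorem child_subwalk (hHG : H ≤ G) (p : H.Walk u v) (a : ℕ) :
    ∀ k, a + k ≤ p.length → ∃ w : G.Walk (p.getVert a) (p.getVert (a + k)),
      ∀ z ∈ w.support, ∃ m, a ≤ m ∧ m ≤ a + k ∧ p.getVert m = z := by
  intro k
  induction k with
  | zero =>
    intro _
    refine ⟨SimpleGraph.Walk.nil, fun z hz => ⟨a, le_rfl, le_rfl, ?_⟩⟩
    rw [SimpleGraph.Walk.support_nil, List.mem_singleton] at hz
    exact hz.symm
  | succ k ih =>
    intro hk
    obtain ⟨w, hw⟩ := ih (by omega)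
    have hadj : G.Adj (p.getVert (a + k)) (p.getVert (a + k + 1)) :=
      hHG (p.adj_getVert_succ (by omega))
    refine ⟨w.concat hadj, fun z hz => ?_⟩
    rw [SimpleGraph.Walk.support_concat, List.mem_append, List.mem_singleton] at hz
    rcases hz with hz | rfl
    · obtain ⟨m, h1, h2, h3⟩ := hw z hz
      exact ⟨m, h1, by omega, h3⟩
    · exact ⟨a + k + 1, by omega, le_rfl, rfl⟩

/-- **Sub-walk by indices**, two-index form: for `a ≤ b ≤ |p|` a `G`-walk from `p a` to `p b` through vertices
`p m`, `a ≤ m ≤ b` only. [folklore] -/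
theorem child_subwalk' (hHG : H ≤ G) (p : H.Walk u v) {a b : ℕ} (hab : a ≤ b) (hb : b ≤ p.length) :
    ∃ w : G.Walk (p.getVert a) (p.getVert b), ∀ z ∈ w.support, ∃ m, a ≤ m ∧ m ≤ b ∧ p.getVert m = z := by
  obtain ⟨k, rfl⟩ := Nat.exists_eq_add_of_le hab
  exact child_subwalk hHG p a k hb

end Subwalk

namespace PresCfg

variable {D : DobrushinDomain} (cfg : PresCfg D)

/-! ### Pieces and their ends -/

/-- The domain graph is a subgraph of the lattice. [folklore] -/
theorem child_Dg_le : cfg.Dg ≤ zdGraph 2 :=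
  (discreteDomainGraph_le_meshGraph _ _).trans (meshGraph_le_zdGraph _ _)

/-- The defects are spine sites. [folklore] -/
theorem child_S_subset_Sp : cfg.S ⊆ cfg.Sp := fun _ hx => Finset.mem_union_right _ hx

/-- Two pieces with the same start have the same end. [folklore] -/
theorem child_isPiece_end_unique {i' j₁ j₂ : ℕ} (h₁ : IsPiece cfg.γ (↑cfg.Sp) i' j₁)
    (h₂ : IsPiece cfg.γ (↑cfg.Sp) i' j₂) : j₁ = j₂ := by
  by_contra hne
  rcases lt_or_gt_of_ne hne with hlt | hlt
  · exact h₂.2.2.2 j₁ (by have := h₁.2.2.1; omega) hlt h₁.2.1.2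
  · exact h₁.2.2.2 j₂ (by have := h₂.2.2.1; omega) hlt h₂.2.1.2

/-- `pend i'` ends the piece starting at `i'`, if there is one. [folklore] -/
theorem child_pend_spec {i' : ℕ} (h : ∃ j', IsPiece cfg.γ (↑cfg.Sp) i' j') :
    IsPiece cfg.γ (↑cfg.Sp) i' (cfg.pend i') := by
  classical
  unfold PresCfg.pend
  rw [dif_pos h]
  exact Nat.find_spec h

/-- The end of a piece is `pend` of its start. [folklore] -/
theorem child_pend_eq {i' j' : ℕ} (h : IsPiece cfg.γ (↑cfg.Sp) i' j') : cfg.pend i' = j' :=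
  cfg.child_isPiece_end_unique (cfg.child_pend_spec ⟨j', h⟩) h

/-- A far start starts the piece `(i', pend i')`. [folklore] -/
theorem child_isPiece_of_mem_farStarts {i' : ℕ} (h : i' ∈ cfg.farStarts) :
    IsPiece cfg.γ (↑cfg.Sp) i' (cfg.pend i') := by
  obtain ⟨j', hj'⟩ := h
  exact cfg.child_pend_spec ⟨j', hj'.1⟩

/-- Index bounds of a far start: `i' + 2 ≤ pend i' ≤ |γ|`. [folklore] -/
theorem child_idx_of_mem_farStarts {i' : ℕ} (h : i' ∈ cfg.farStarts) :
    i' + 2 ≤ cfg.pend i' ∧ cfg.pend i' ≤ cfg.γ.length :=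
  ⟨(cfg.child_isPiece_of_mem_farStarts h).2.2.1, (cfg.child_isPiece_of_mem_farStarts h).2.1.1⟩

/-! ### Interiors of pieces -/

/-- The first interior vertex of a piece is interior. [folklore] -/
theorem child_getVert_succ_mem_V {i' j' : ℕ} (h : i' + 2 ≤ j') : cfg.γ.getVert (i' + 1) ∈ cfg.V i' j' :=
  ⟨i' + 1, by omega, by omega, rfl⟩

/-- **Interiors of distinct pieces are disjoint** (the chord is self-avoiding and a piece contains no spine
index strictly inside). [folklore] -/
theorem child_V_disjoint {i₁ j₁ i₂ j₂ : ℕ} (h₁ : IsPiece cfg.γ (↑cfg.Sp) i₁ j₁)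
    (h₂ : IsPiece cfg.γ (↑cfg.Sp) i₂ j₂) (hne : i₁ ≠ i₂) : Disjoint (cfg.V i₁ j₁) (cfg.V i₂ j₂) := by
  rw [Set.disjoint_left]
  rintro z ⟨m₁, hm₁, hm₁', rfl⟩ ⟨m₂, hm₂, hm₂', he⟩
  have hL₁ := h₁.2.1.1
  have hL₂ := h₂.2.1.1
  have hm : m₂ = m₁ :=
    cfg.hγ.getVert_injOn (by simp only [Set.mem_setOf_eq]; omega) (by simp only [Set.mem_setOf_eq]; omega) he
  subst hm
  rcases lt_or_gt_of_ne hne with hlt | hlt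
  · -- `i₂` is a spine index in `(i₁, j₁)` unless `j₁ ≤ i₂`
    by_cases hj : i₂ < j₁
    · exact h₁.2.2.2 i₂ hlt hj h₂.1.2
    · omega
  · by_cases hj : i₁ < j₂
    · exact h₂.2.2.2 i₁ hlt hj h₁.1.2
    · omega

/-- **The interior of a piece is joined to its first vertex inside itself.** [folklore] -/
theorem child_V_walk {i' j' : ℕ} (hj' : j' ≤ cfg.γ.length) {x : Site 2} (hx : x ∈ cfg.V i' j') :
    ∃ w : (zdGraph 2).Walk x (cfg.γ.getVert (i' + 1)), ∀ z ∈ w.support, z ∈ cfg.V i' j' := by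
  obtain ⟨m, hm, hm', rfl⟩ := hx
  obtain ⟨w, hw⟩ := child_subwalk' cfg.child_Dg_le cfg.γ (show i' + 1 ≤ m by omega) (by omega)
  refine ⟨w.reverse, fun z hz => ?_⟩
  rw [SimpleGraph.Walk.support_reverse, List.mem_reverse] at hz
  obtain ⟨m', h1, h2, rfl⟩ := hw z hz
  exact ⟨m', by omega, by omega, rfl⟩

/-- Two interior vertices of a piece are joined inside its interior. [folklore] -/
theorem child_V_walk₂ {i' j' : ℕ} (hj' : j' ≤ cfg.γ.length) {x y : Site 2} (hx : x ∈ cfg.V i' j')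
    (hy : y ∈ cfg.V i' j') : ∃ w : (zdGraph 2).Walk x y, ∀ z ∈ w.support, z ∈ cfg.V i' j' := by
  obtain ⟨wx, hwx⟩ := cfg.child_V_walk hj' hx
  obtain ⟨wy, hwy⟩ := cfg.child_V_walk hj' hy
  refine ⟨wx.append wy.reverse, fun z hz => ?_⟩
  rw [SimpleGraph.Walk.mem_support_append_iff, SimpleGraph.Walk.support_reverse, List.mem_reverse] at hz
  exact hz.elim (hwx z) (hwy z)

/-- An edge of the chord between two non-defect vertices is a carrier edge, so both ends are in `Λ`.
[folklore] -/
theorem child_getVert_mem_Λ_of_adj {m : ℕ} (hm : m < cfg.γ.length) (h₀ : cfg.γ.getVert m ∉ cfg.S)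
    (h₁ : cfg.γ.getVert (m + 1) ∉ cfg.S) :
    cfg.γ.getVert m ∈ cfg.Λ ∧ cfg.γ.getVert (m + 1) ∈ cfg.Λ := by
  have hG := (cfg.hid _ _).2 ⟨cfg.γ.adj_getVert_succ hm, h₀, h₁⟩
  exact ⟨(discreteDomainGraph_adj_iff.1 hG).2.1, (discreteDomainGraph_adj_iff.1 hG).2.2⟩

/-- **Interior vertices of a non-degenerate piece are free**: in `Λ` (a neighbouring chord edge has both ends
off the defects, hence is a carrier edge) and off the spine. [folklore] -/
theorem child_getVert_mem_U {i' j' m : ℕ} (hP : IsPiece cfg.γ (↑cfg.Sp) i' j') (hnd : i' + 3 ≤ j')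
    (h1 : i' < m) (h2 : m < j') : cfg.γ.getVert m ∈ cfg.U := by
  have hL := hP.2.1.1
  have hSp : ∀ n, i' < n → n < j' → cfg.γ.getVert n ∉ cfg.S := fun n hn hn' hS =>
    hP.2.2.2 n hn hn' (Finset.mem_coe.2 (cfg.child_S_subset_Sp hS))
  refine ⟨?_, hP.2.2.2 m h1 h2⟩
  by_cases hm : m + 1 < j'
  · exact (cfg.child_getVert_mem_Λ_of_adj (by omega) (hSp m h1 h2) (hSp (m + 1) (by omega) hm)).1
  · obtain ⟨m', rfl⟩ : ∃ m', m = m' + 1 := ⟨m - 1, by omega⟩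
    exact (cfg.child_getVert_mem_Λ_of_adj (by omega) (hSp m' (by omega) (by omega)) (hSp (m' + 1) h1 h2)).2

/-- **The interior of a non-degenerate far piece lies in the free territory `U = Λ ∖ Sp`.** [folklore] -/
theorem child_V_subset_U : ∀ {D : DobrushinDomain} (cfg : PresCfg D) (i' : ℕ), i' ∈ cfg.farStarts → cfg.NonDeg i' → cfg.V i' (cfg.pend i') ⊆ cfg.U := by
  intro D cfg i' hfs hnd z hz
  obtain ⟨m, hm, hm', rfl⟩ := hz
  exact cfg.child_getVert_mem_U (cfg.child_isPiece_of_mem_farStarts hfs) hnd hm hm'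

/-! ### The free territory, its components and roots -/

/-- Vertices of the presenting walk are off the lattice domain. [folklore] -/
theorem child_notMem_Λ_of_mem_support {x : Site 2} (hx : x ∈ cfg.C.support) : x ∉ cfg.Λ := fun h =>
  Negative.notMem_dom_of_mem_support cfg.C cfg.δ hx (meshDomain_subset_meshVertices _ _ h)

/-- A free site is its own component's member. [folklore] -/
theorem child_mem_compU_self {z : Site 2} (hz : z ∈ cfg.U) : z ∈ cfg.compU z :=
  ⟨SimpleGraph.Walk.nil, fun v hv => by
    rw [SimpleGraph.Walk.support_nil, List.mem_singleton] at hv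
    exact hv ▸ hz⟩

/-- Components lie in `U`. [folklore] -/
theorem child_mem_U_of_mem_compU {x z : Site 2} (h : x ∈ cfg.compU z) : x ∈ cfg.U := by
  obtain ⟨w, hw⟩ := h
  exact hw x w.start_mem_support

/-- A nonempty component has its centre in `U`. [folklore] -/
theorem child_mem_U_of_mem_compU' {x z : Site 2} (h : x ∈ cfg.compU z) : z ∈ cfg.U := by
  obtain ⟨w, hw⟩ := h
  exact hw z w.end_mem_support

/-- **Components are closed under `U`-walks.** [folklore] -/
theorem child_mem_compU_of_walk {x y z : Site 2} (w : (zdGraph 2).Walk x y) (hw : ∀ v ∈ w.support, v ∈ cfg.U)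
    (hy : y ∈ cfg.compU z) : x ∈ cfg.compU z := by
  obtain ⟨w', hw'⟩ := hy
  refine ⟨w.append w', fun v hv => ?_⟩
  rw [SimpleGraph.Walk.mem_support_append_iff] at hv
  exact hv.elim (hw v) (hw' v)

/-- Membership in a component is symmetric. [folklore] -/
theorem child_mem_compU_symm {x z : Site 2} (h : x ∈ cfg.compU z) : z ∈ cfg.compU x := by
  obtain ⟨w, hw⟩ := h
  refine ⟨w.reverse, fun v hv => hw v ?_⟩
  rwa [SimpleGraph.Walk.support_reverse, List.mem_reverse] at hv

/-- **`compU` is an equivalence class**: a member's component is the component. [folklore] -/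
theorem child_compU_eq_of_mem {z z' : Site 2} (h : z' ∈ cfg.compU z) : cfg.compU z' = cfg.compU z := by
  ext x
  constructor
  · rintro ⟨w, hw⟩
    exact cfg.child_mem_compU_of_walk w hw h
  · rintro ⟨w, hw⟩
    exact cfg.child_mem_compU_of_walk w hw (cfg.child_mem_compU_symm h)

/-- The root of a nonempty component is a member of it. [folklore] -/
theorem child_rootAt_mem {z : Site 2} (hz : z ∈ cfg.U) : cfg.rootAt z ∈ cfg.compU z := by
  classical
  have hne : (cfg.compU z).Nonempty := ⟨z, cfg.child_mem_compU_self hz⟩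
  unfold PresCfg.rootAt
  rw [dif_pos hne]
  exact hne.some_mem

/-- Choice of a member depends only on the set. [folklore] -/
private theorem child_some_congr {s t : Set (Site 2)} (hs : s.Nonempty) (ht : t.Nonempty) (h : s = t) :
    hs.some = ht.some := by
  subst h
  rfl

/-- **The root depends only on the component.** [folklore] -/
theorem child_rootAt_congr {z z' : Site 2} (h : cfg.compU z = cfg.compU z') (hne : (cfg.compU z).Nonempty) :
    cfg.rootAt z = cfg.rootAt z' := by
  classical
  have hne' : (cfg.compU z').Nonempty := h ▸ hne
  unfold PresCfg.rootAt
  rw [dif_pos hne, dif_pos hne']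
  exact child_some_congr hne hne' h

/-- Roots of members agree. [folklore] -/
theorem child_rootAt_eq_of_mem {z z' : Site 2} (h : z' ∈ cfg.compU z) : cfg.rootAt z' = cfg.rootAt z :=
  cfg.child_rootAt_congr (cfg.child_compU_eq_of_mem h) ⟨z', cfg.child_mem_compU_self (cfg.child_mem_U_of_mem_compU h)⟩

end PresCfg

namespace PresCfg

variable {D : DobrushinDomain} (cfg : PresCfg D)

/-- Unfolding membership in `desc`. [folklore] -/
theorem child_mem_desc_iff {i' i'' : ℕ} : i'' ∈ cfg.desc i' ↔
    i'' < cfg.γ.length + 1 ∧ i'' ≠ i' ∧ i'' ∈ cfg.farStarts ∧ cfg.NonDeg i'' ∧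
      cfg.γ.getVert (i'' + 1) ∈ cfg.compU (cfg.γ.getVert (i' + 1)) ∧
      ∀ x ∈ cfg.V i'' (cfg.pend i''), ∀ w : (zdGraph 2).Walk x (cfg.rootAt (cfg.γ.getVert (i' + 1))),
        (∀ v ∈ w.support, v ∈ cfg.U) → ∃ v ∈ w.support, v ∈ cfg.V i' (cfg.pend i') := by
  classical
  unfold PresCfg.desc
  rw [Finset.mem_filter, Finset.mem_range]

/-- The first interior vertex of a non-degenerate far piece is free. [folklore] -/
theorem child_getVert_succ_mem_U {i' : ℕ} (hfs : i' ∈ cfg.farStarts) (hnd : cfg.NonDeg i') :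
    cfg.γ.getVert (i' + 1) ∈ cfg.U :=
  cfg.child_V_subset_U i' hfs hnd (cfg.child_getVert_succ_mem_V (cfg.child_idx_of_mem_farStarts hfs).1)

/-- Transport of the separation clause along an equality of roots. [folklore] -/
theorem child_clause_transport {r r' : Site 2} (h : r = r') {A B : Set (Site 2)}
    (hc : ∀ x ∈ A, ∀ w : (zdGraph 2).Walk x r, (∀ v ∈ w.support, v ∈ cfg.U) → ∃ v ∈ w.support, v ∈ B) :
    ∀ x ∈ A, ∀ w : (zdGraph 2).Walk x r', (∀ v ∈ w.support, v ∈ cfg.U) → ∃ v ∈ w.support, v ∈ B := by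
  subst h
  exact hc

end PresCfg

/-- **Registered helper (witness glue T4, part 1): ranks decrease strictly along descent.**  For a
non-degenerate far piece `i`, every descendant `i'' ∈ desc i` has `rk i'' < rk i`: instantiate the abstract
`card_desc_lt_of_mem_desc` with the non-degenerate far pieces of the `U`-component of `γ (i + 1)`, their interiors,
the root `rootAt (γ (i + 1))`, and observe that on these pieces `desc` is the abstract descendant set (components
and roots agree inside one `U`-component). [folklore] -/
theorem child_rk_lt_of_mem_desc : ∀ {D : DobrushinDomain} (cfg : PresCfg D) (i i'' : ℕ), i ∈ cfg.farStarts → cfg.NonDeg i → i'' ∈ cfg.desc i → cfg.rk i'' < cfg.rk i := by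
  intro D cfg i i'' hfs hnd hmem
  classical
  -- the root and the pieces of the component of `γ (i + 1)`
  have hiU : cfg.γ.getVert (i + 1) ∈ cfg.U := cfg.child_getVert_succ_mem_U hfs hnd
  have hz₀ : cfg.rootAt (cfg.γ.getVert (i + 1)) ∈ cfg.compU (cfg.γ.getVert (i + 1)) := cfg.child_rootAt_mem hiU
  set pieces : Finset ℕ := (Finset.range (cfg.γ.length + 1)).filter fun P =>
    P ∈ cfg.farStarts ∧ cfg.NonDeg P ∧ cfg.γ.getVert (P + 1) ∈ cfg.compU (cfg.γ.getVert (i + 1)) with hpieces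
  set desc' : ℕ → Finset ℕ := fun P => pieces.filter fun R => R ≠ P ∧
    ∀ x ∈ cfg.V R (cfg.pend R), ∀ w : (zdGraph 2).Walk x (cfg.rootAt (cfg.γ.getVert (i + 1))),
      (∀ z ∈ w.support, z ∈ cfg.U) → ∃ z ∈ w.support, z ∈ cfg.V P (cfg.pend P) with hdesc'
  have hmemp : ∀ P, P ∈ pieces ↔ P < cfg.γ.length + 1 ∧ P ∈ cfg.farStarts ∧ cfg.NonDeg P ∧
      cfg.γ.getVert (P + 1) ∈ cfg.compU (cfg.γ.getVert (i + 1)) := fun P => by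
    rw [hpieces, Finset.mem_filter, Finset.mem_range]
  -- on the pieces of the component, `desc` is the abstract descendant set
  have hagree : ∀ P ∈ pieces, cfg.desc P = desc' P := by
    intro P hP
    obtain ⟨-, hPfs, hPnd, hPc⟩ := (hmemp P).1 hP
    have hcomp : cfg.compU (cfg.γ.getVert (P + 1)) = cfg.compU (cfg.γ.getVert (i + 1)) :=
      cfg.child_compU_eq_of_mem hPc
    have hroot : cfg.rootAt (cfg.γ.getVert (P + 1)) = cfg.rootAt (cfg.γ.getVert (i + 1)) :=
      cfg.child_rootAt_eq_of_mem hPc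
    ext R
    rw [cfg.child_mem_desc_iff, hdesc', Finset.mem_filter, hmemp, hcomp]
    constructor
    · rintro ⟨hR, hRP, hRfs, hRnd, hRc, hcl⟩
      exact ⟨⟨hR, hRfs, hRnd, hRc⟩, hRP, cfg.child_clause_transport hroot hcl⟩
    · rintro ⟨⟨hR, hRfs, hRnd, hRc⟩, hRP, hcl⟩
      exact ⟨hR, hRP, hRfs, hRnd, hRc, cfg.child_clause_transport hroot.symm hcl⟩
  have hi : i ∈ pieces := (hmemp i).2
    ⟨by have := cfg.child_idx_of_mem_farStarts hfs; omega, hfs, hnd, cfg.child_mem_compU_self hiU⟩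
  have hi'' : i'' ∈ desc' i := hagree i hi ▸ hmem
  have hi''p : i'' ∈ pieces := (Finset.mem_filter.1 hi'').1
  -- the abstract rank lemma
  have key := card_desc_lt_of_mem_desc (G := zdGraph 2) cfg.U (cfg.rootAt (cfg.γ.getVert (i + 1))) pieces
    (fun P => cfg.V P (cfg.pend P)) desc' ?_ ?_ ?_ ?_ i hi i'' hi''
  · unfold PresCfg.rk
    rwa [hagree i hi, hagree i'' hi''p]
  · -- interiors of distinct pieces are disjoint
    intro P hP R hR hPR
    exact cfg.child_V_disjoint (cfg.child_isPiece_of_mem_farStarts ((hmemp P).1 hP).2.1)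
      (cfg.child_isPiece_of_mem_farStarts ((hmemp R).1 hR).2.1) hPR
  · -- interiors are nonempty
    intro P hP
    exact ⟨_, cfg.child_getVert_succ_mem_V (cfg.child_idx_of_mem_farStarts ((hmemp P).1 hP).2.1).1⟩
  · -- every interior vertex is joined to the root inside `U`
    intro P hP x hx
    obtain ⟨-, hPfs, hPnd, hPc⟩ := (hmemp P).1 hP
    obtain ⟨w₁, hw₁⟩ := cfg.child_V_walk (cfg.child_idx_of_mem_farStarts hPfs).2 hx
    have hx' : x ∈ cfg.compU (cfg.γ.getVert (i + 1)) :=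
      cfg.child_mem_compU_of_walk w₁ (fun z hz => cfg.child_V_subset_U P hPfs hPnd (hw₁ z hz)) hPc
    obtain ⟨w₂, hw₂⟩ := cfg.child_mem_compU_symm hz₀
    obtain ⟨w₃, hw₃⟩ := hx'
    refine ⟨w₃.append w₂, fun z hz => ?_⟩
    rw [SimpleGraph.Walk.mem_support_append_iff] at hz
    exact hz.elim (hw₃ z) (hw₂ z)
  · -- the abstract descendant set, by definition
    intro P R
    rw [hdesc', Finset.mem_filter]

end Summit.CriticalPhenomena.SAWScalingLimit.Theorems.FKGToTraversalBound.SlitNecklace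

end
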